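import Summits.ResolutionOfSingularities.ResolutionOfSingularities.Theorems.FrobeniusLadderFInjectiveMacaulayficationBlowupAlgebraLocalization
import Mathlib.RingTheory.Localization.Algebra
import Mathlib.RingTheory.Polynomial.Basic
import HarnessLib

/-!
# Affine blow-up algebras commute with `R → R[t]`: `R[t][I R[t]/a] ≅ (R[I/a])[t]`
# (crux `FInjectiveMacaulayfication` stmt-ResolutionOfSingularities-15315, chain w45a; R11.11 cylinder producer, step S3;
# owner res-D-pv-017 AS res-L1-w45a-stub-5)

Support file for crux stmt-ResolutionOfSingularities-15315 (`FrobeniusLadder.FInjectiveMacaulayfication`), chain w45a.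
[OURS · L1 W4.5a] — NOT a statement of any manuscript; AI-written, weaker than expert review.

For any commutative ring `R`, ideal `I` and `a ∈ R`: inside `R[t][1/a] ≅ R[1/a][t]` (`Polynomial.isLocalization`) the affine
blow-up algebra of `I·R[t]` at `a` is the polynomial ring over the affine blow-up algebra of `I` at `a`
(`nonempty_ringEquiv_polynomial`): a generator `x'/a`, `x' = Σ xₙ tⁿ ∈ I·R[t]`, is `Σ (xₙ/a) tⁿ`. The chart rings of
`Bl_{I R[t]} (𝔸¹ × Spec R) = 𝔸¹ × Bl_I Spec R`. No definitions, no named facts. [folklore; flat base change of blow-up algebras,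
cf. Stacks 0805]
-/

-- single-problem summit: the doubled namespace component is forced
set_option linter.dupNamespace false

noncomputable section

open Polynomial Literature.AlgebraicGeometry.Resolution IsLocalization

namespace Summit.ResolutionOfSingularities.ResolutionOfSingularities.Theorems.FInjectiveMacaulayfication.BlowupAlgebraPolynomial

open Summit.ResolutionOfSingularities.ResolutionOfSingularities.Theorems.FInjectiveMacaulayfication

set_option maxHeartbeats 1600000 in
/-- **`R[t][I·R[t]/a] ≅ (R[I/a])[t]`** as rings, for any commutative ring `R`, ideal `I ⊆ R` and `a ∈ R`. [folklore] -/
theorem nonempty_ringEquiv_polynomial {R : Type} [CommRing R] (I : Ideal R) (a : R) :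
    Nonempty ((blowupAlgebra I a)[X] ≃+* blowupAlgebra (I.map (C : R →+* R[X])) (C a)) := by
  classical
  -- `L = R[1/a]`, `L[t]` is `R[t][1/a]`
  letI algL : Algebra R[X] (Localization.Away a)[X] := Polynomial.algebra R (Localization.Away a)
  have halg : ∀ f : R[X], algebraMap R[X] (Localization.Away a)[X] f = f.map (algebraMap R (Localization.Away a)) := fun f => rfl
  haveI : IsLocalization (Submonoid.powers (C a)) (Localization.Away a)[X] := by
    rw [← Submonoid.map_powers]; exact Polynomial.isLocalization (Submonoid.powers a) (Localization.Away a)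
  let e₀ : (Localization.Away a)[X] ≃ₐ[R[X]] Localization.Away (C a) :=
    IsLocalization.algEquiv (Submonoid.powers (C a)) (Localization.Away a)[X] (Localization.Away (C a))
  -- values of `e₀` on constants and on `t`
  have he₀C : ∀ r : R, e₀ (C (algebraMap R (Localization.Away a) r)) = algebraMap R[X] (Localization.Away (C a)) (C r) := by
    intro r
    rw [← e₀.commutes (C r), halg, map_C]
  have he₀X : e₀ X = algebraMap R[X] (Localization.Away (C a)) X := by
    rw [← e₀.commutes X, halg, Polynomial.map_X]
  have he₀inv : e₀ (C (Away.invSelf a)) = Away.invSelf (C a) := by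
    have h1 : C (Away.invSelf a) * C (algebraMap R (Localization.Away a) a) = (1 : (Localization.Away a)[X]) := by
      rw [← map_mul, mul_comm, Away.mul_invSelf, map_one]
    have h2 : e₀ (C (Away.invSelf a)) * algebraMap R[X] (Localization.Away (C a)) (C a) = 1 := by
      rw [← he₀C, ← map_mul, h1, map_one]
    have h3 : Away.invSelf (C a) * algebraMap R[X] (Localization.Away (C a)) (C a) = 1 := by
      rw [mul_comm, Away.mul_invSelf]
    calc e₀ (C (Away.invSelf a)) = e₀ (C (Away.invSelf a)) * (algebraMap R[X] (Localization.Away (C a)) (C a) * Away.invSelf (C a)) := by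
          rw [mul_comm (algebraMap R[X] _ (C a)), h3, mul_one]
      _ = Away.invSelf (C a) := by rw [← mul_assoc, h2, one_mul]
  -- `e₀ ∘ C` maps `R[I/a]` into `R[t][I R[t]/a]`
  have hCmem : ∀ y : Localization.Away a, y ∈ blowupAlgebra I a → e₀ (C y) ∈ blowupAlgebra (I.map (C : R →+* R[X])) (C a) := by
    intro y hy
    refine Algebra.adjoin_induction (hx := hy) ?_ ?_ ?_ ?_
    · rintro _ ⟨x, hx, rfl⟩
      rw [map_mul, map_mul, he₀C, he₀inv]
      exact div_mem_blowupAlgebra _ _ (Ideal.mem_map_of_mem _ hx)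
    · intro r
      rw [he₀C]
      exact Subalgebra.algebraMap_mem _ _
    · intro x y _ _ hx hy
      rw [map_add, map_add]; exact Subalgebra.add_mem _ hx hy
    · intro x y _ _ hx hy
      rw [map_mul, map_mul]; exact Subalgebra.mul_mem _ hx hy
  have hXmem : e₀ X ∈ blowupAlgebra (I.map (C : R →+* R[X])) (C a) := by
    rw [he₀X]; exact Subalgebra.algebraMap_mem _ _
  -- the candidate map `Φ = e₀ ∘ (coefficientwise inclusion)`
  let Φ : (blowupAlgebra I a)[X] →+* Localization.Away (C a) :=
    e₀.toRingEquiv.toRingHom.comp (mapRingHom (blowupAlgebra I a).val.toRingHom)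
  have hΦ : ∀ q, Φ q = e₀ (q.map (blowupAlgebra I a).val.toRingHom) := fun q => rfl
  have hΦinj : Function.Injective Φ :=
    e₀.injective.comp (Polynomial.map_injective _ Subtype.val_injective)
  have hΦC : ∀ b : blowupAlgebra I a, Φ (C b) = e₀ (C (b : Localization.Away a)) := fun b => by
    rw [hΦ, Polynomial.map_C]; rfl
  have hΦX : Φ X = e₀ X := by rw [hΦ, Polynomial.map_X]
  have hrange : ∀ q, Φ q ∈ blowupAlgebra (I.map (C : R →+* R[X])) (C a) := by
    intro q
    induction q using Polynomial.induction_on' with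
    | add f g hf hg => rw [map_add]; exact Subalgebra.add_mem _ hf hg
    | monomial n b =>
      rw [← C_mul_X_pow_eq_monomial, map_mul, map_pow, hΦC, hΦX]
      exact Subalgebra.mul_mem _ (hCmem _ b.2) (Subalgebra.pow_mem _ hXmem n)
  -- surjectivity onto `R[t][I R[t]/a]`
  have hsurj : ∀ y : Localization.Away (C a), y ∈ blowupAlgebra (I.map (C : R →+* R[X])) (C a) → ∃ q, Φ q = y := by
    intro y hy
    refine Algebra.adjoin_induction (hx := hy) ?_ ?_ ?_ ?_
    · rintro _ ⟨x', hx', rfl⟩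
      -- `x' = Σ xₙ tⁿ` with `xₙ ∈ I`; preimage `Σ (xₙ/a) tⁿ`
      have hcoeff : ∀ n, x'.coeff n ∈ I := fun n => Ideal.mem_map_C_iff.mp hx' n
      refine ⟨∑ n ∈ x'.support, C (⟨algebraMap R (Localization.Away a) (x'.coeff n) * Away.invSelf a,
        div_mem_blowupAlgebra I a (hcoeff n)⟩ : blowupAlgebra I a) * X ^ n, ?_⟩
      rw [map_sum]
      simp only [map_mul, map_pow, hΦC, hΦX, he₀C, he₀inv, he₀X]
      conv_rhs => rw [x'.as_sum_support_C_mul_X_pow]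
      rw [map_sum, Finset.sum_mul]
      refine Finset.sum_congr rfl fun n _ => ?_
      rw [map_mul, map_pow]
      ring
    · intro r'
      refine ⟨r'.map (algebraMap R (blowupAlgebra I a)), ?_⟩
      rw [hΦ, Polynomial.map_map]
      have : ((blowupAlgebra I a).val.toRingHom).comp (algebraMap R (blowupAlgebra I a)) = algebraMap R (Localization.Away a) :=
        RingHom.ext fun r => rfl
      rw [this, ← halg, e₀.commutes]
    · rintro x y - - ⟨q₁, hq₁⟩ ⟨q₂, hq₂⟩
      exact ⟨q₁ + q₂, by rw [map_add, hq₁, hq₂]⟩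
    · rintro x y - - ⟨q₁, hq₁⟩ ⟨q₂, hq₂⟩
      exact ⟨q₁ * q₂, by rw [map_mul, hq₁, hq₂]⟩
  -- assemble the isomorphism
  let Φ' : (blowupAlgebra I a)[X] →+* blowupAlgebra (I.map (C : R →+* R[X])) (C a) :=
    Φ.codRestrict (blowupAlgebra (I.map (C : R →+* R[X])) (C a)) hrange
  refine ⟨RingEquiv.ofBijective Φ' ⟨fun q₁ q₂ h => hΦinj (congrArg Subtype.val h), fun y => ?_⟩⟩
  obtain ⟨q, hq⟩ := hsurj y.1 y.2
  exact ⟨q, Subtype.ext hq⟩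

end Summit.ResolutionOfSingularities.ResolutionOfSingularities.Theorems.FInjectiveMacaulayfication.BlowupAlgebraPolynomial

end
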